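import Literature.MathematicalPhysics.QuantumManyBody.BoseGasConfigLineGap
import HarnessLib

/-!
# Route `BECInfraredBound`, crux `BecShellMass` (stmt-AtomisticToContinuum-0734), line `Sketch`:
# the registered stub `stub_boundaryLayerPoincare`

Supports (does not close) stmt-AtomisticToContinuum-0734; stub `stub_boundaryLayerPoincare` of the
line `Sketch` (the free-gas branch of the no-boundary-accumulation crux `BecShellMass`).

**Boundary-layer Poincaré inequality for Dirichlet trial states.**  For `0 < w`, `2w ≤ L` and a
Dirichlet trial state `Ψ` of `N` bosons in the box `Λ_L = (0, L)³`, the expected number of particles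
within sup-distance `w` of the boundary is at most `w²` times the kinetic energy:

`∑ᵢ ∫ 1[Xᵢ ∉ (w, L - w)³] |Ψ(X)|² dX ≤ w² ∫ |∇Ψ|²`.

Proof.  Pointwise `1[x ∉ (w, L - w)³] ≤ ∑ₐ (1[xₐ ≤ w] + 1[L - w ≤ xₐ])` (`shell_indicator_le`: a
point all of whose coordinates lie in `(w, L - w)` is in the open inner cube).  For a fixed particle
`i` and axis `a`, on the coordinate line `t ↦ f(t) = Ψ(…, x_{i,a} = t, …)` — a `C¹` function
vanishing off `(0, L)` (tree `line_data`) — the one-dimensional Poincaré inequality with a zero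
(tree `poincare_Ioo_of_zero`) on `(0, w)` with the zero at `0` and on `(L - w, L)` with the zero at
`L` gives `∫ (1[t ≤ w] + 1[L - w ≤ t]) |f|² ≤ w² (∫_{(0,w)} |f'|² + ∫_{(L-w,L)} |f'|²) ≤ w² ∫ |f'|²`,
the two intervals being disjoint because `2w ≤ L` (`line_twoSlab_le`).  Fubini over the lines
(tree `lintegral_le_of_forall_line`) lifts this to configuration space (`config_twoSlab_le`), and
summing over the three axes and the particles gives `w² ∑ₐ ∑ᵢ ∫ |∂_{i,a}Ψ|² = w² ∫ |∇Ψ|²` (tree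
`sum_directionalEnergy_eq`).  The corner case `N = 0` is the empty sum.

No definitions; `[0, ∞]`-valued integrals throughout, so no integrability side conditions.

## References

* E. H. Lieb, R. Seiringer, J. P. Solovej, J. Yngvason, *The Mathematics of the Bose Gas and its
  Condensation* (2005), Ch. 2, (2.3) (Dirichlet trial states of the box; the estimate itself is the
  standard one-dimensional Poincaré inequality on an interval with a zero, folklore).
  [cite: LSSY2005, Ch. 2 (2.3)]
-/

noncomputable section

open MeasureTheory Set
open scoped ENNReal

namespace Summit.AtomisticToContinuum.BoseEinsteinCondensation.Theorems.BecShellMass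

open Literature.MathematicalPhysics.QuantumManyBody.BoseGas

namespace BoundaryLayerPoincare

variable {N : ℕ} {L w : ℝ}

/-! ### The shell is covered by six coordinate slabs -/

/-- **The shell indicator is dominated by the six slab indicators**: for `x ∈ ℝ³`,
`1[x ∉ (w, L - w)³] ≤ ∑ₐ (1[xₐ ≤ w] + 1[L - w ≤ xₐ])` (if every coordinate lies in `(w, L - w)`
the point lies in the open inner cube). [folklore] -/
theorem shell_indicator_le (w L : ℝ) (x : EuclideanSpace ℝ (Fin 3)) :
    {x : EuclideanSpace ℝ (Fin 3) | ∀ j, x j ∈ Set.Ioo w (L - w)}ᶜ.indicator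
        (fun _ => (1 : ℝ≥0∞)) x ≤
      ∑ a : Fin 3, ((Iic w).indicator (fun _ => (1 : ℝ≥0∞)) (x a) +
        (Ici (L - w)).indicator (fun _ => (1 : ℝ≥0∞)) (x a)) := by
  by_cases hx : x ∈ ({x : EuclideanSpace ℝ (Fin 3) | ∀ j, x j ∈ Set.Ioo w (L - w)}ᶜ)
  · rw [indicator_of_mem hx]
    rw [mem_compl_iff, mem_setOf_eq, not_forall] at hx
    obtain ⟨j, hj⟩ := hx
    calc (1 : ℝ≥0∞)
        ≤ (Iic w).indicator (fun _ => (1 : ℝ≥0∞)) (x j) +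
            (Ici (L - w)).indicator (fun _ => (1 : ℝ≥0∞)) (x j) := by
          rcases le_or_gt (x j) w with hjw | hjw
          · rw [indicator_of_mem (show x j ∈ Iic w from hjw)]
            exact le_self_add
          · rw [indicator_of_mem (show x j ∈ Ici (L - w) from not_lt.1 fun h => hj ⟨hjw, h⟩)]
            exact le_add_self
      _ ≤ ∑ a : Fin 3, ((Iic w).indicator (fun _ => (1 : ℝ≥0∞)) (x a) +
            (Ici (L - w)).indicator (fun _ => (1 : ℝ≥0∞)) (x a)) :=
          Finset.single_le_sum (f := fun a : Fin 3 => (Iic w).indicator (fun _ => (1 : ℝ≥0∞)) (x a) +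
            (Ici (L - w)).indicator (fun _ => (1 : ℝ≥0∞)) (x a)) (fun _ _ => zero_le)
            (Finset.mem_univ j)
  · rw [indicator_of_notMem hx]
    exact zero_le

/-! ### One coordinate line: the two slabs -/

/-- **Two-slab Poincaré inequality on a line.**  If `f : ℝ → ℂ` has the continuous derivative
`f'`, vanishes off `(0, L)`, and `0 ≤ w`, `2w ≤ L`, then
`∫ (1[t ≤ w] + 1[L - w ≤ t]) |f t|² dt ≤ w² ∫ |f' t|² dt`: the one-dimensional Poincaré
inequality with a zero on `(0, w)` (zero at `0`) and on `(L - w, L)` (zero at `L`), the two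
intervals being disjoint. [folklore] -/
theorem line_twoSlab_le {f f' : ℝ → ℂ} (hw : 0 ≤ w) (hwL : 2 * w ≤ L)
    (hderiv : ∀ t, HasDerivAt f (f' t) t) (hcont : Continuous f) (hcont' : Continuous f')
    (hzero : ∀ t, t ∉ Ioo 0 L → f t = 0) :
    ∫⁻ t, ((Iic w).indicator (fun _ => (1 : ℝ≥0∞)) t +
          (Ici (L - w)).indicator (fun _ => (1 : ℝ≥0∞)) t) * ((‖f t‖₊ : ℝ≥0∞)) ^ 2 ≤
      ENNReal.ofReal (w ^ 2) * ∫⁻ t, ((‖f' t‖₊ : ℝ≥0∞)) ^ 2 := by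
  have hmf : Measurable fun t => ((‖f t‖₊ : ℝ≥0∞)) ^ 2 :=
    (hcont.measurable.nnnorm.coe_nnreal_ennreal).pow_const 2
  have h0 : f 0 = 0 := hzero 0 fun h => (lt_irrefl (0 : ℝ)) h.1
  have hL0 : f L = 0 := hzero L fun h => (lt_irrefl L) h.2
  -- the left slab `t ≤ w`: Poincaré on `(0, w)` with the zero at `0`
  have hleft : ∫⁻ t, (Iic w).indicator (fun _ => (1 : ℝ≥0∞)) t * ((‖f t‖₊ : ℝ≥0∞)) ^ 2 ≤
      ENNReal.ofReal (w ^ 2) * ∫⁻ t in Ioo 0 w, ((‖f' t‖₊ : ℝ≥0∞)) ^ 2 := by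
    calc ∫⁻ t, (Iic w).indicator (fun _ => (1 : ℝ≥0∞)) t * ((‖f t‖₊ : ℝ≥0∞)) ^ 2
        ≤ ∫⁻ t, (Ioc 0 w).indicator (fun t => ((‖f t‖₊ : ℝ≥0∞)) ^ 2) t := by
          refine lintegral_mono fun t => ?_
          by_cases ht : t ∈ Ioc 0 w
          · simp only [indicator_of_mem ht, indicator_of_mem (show t ∈ Iic w from ht.2), one_mul,
              le_refl]
          · rcases le_or_gt t 0 with ht0 | ht0
            · simp [hzero t fun h => (not_lt.2 ht0) h.1]
            · simp only [indicator_of_notMem ht,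
                indicator_of_notMem (show t ∉ Iic w from fun h => ht ⟨ht0, h⟩), zero_mul, le_refl]
      _ = ∫⁻ t in Ioo 0 w, ((‖f t‖₊ : ℝ≥0∞)) ^ 2 := by
          rw [lintegral_indicator measurableSet_Ioc]
          exact setLIntegral_congr Ioo_ae_eq_Ioc.symm
      _ ≤ ENNReal.ofReal ((w - 0) ^ 2) * ∫⁻ t in Ioo 0 w, ((‖f' t‖₊ : ℝ≥0∞)) ^ 2 :=
          poincare_Ioo_of_zero (tz := 0) ⟨le_rfl, hw⟩ h0 hderiv hcont'
      _ = ENNReal.ofReal (w ^ 2) * ∫⁻ t in Ioo 0 w, ((‖f' t‖₊ : ℝ≥0∞)) ^ 2 := by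
          rw [sub_zero]
  -- the right slab `L - w ≤ t`: Poincaré on `(L - w, L)` with the zero at `L`
  have hright : ∫⁻ t, (Ici (L - w)).indicator (fun _ => (1 : ℝ≥0∞)) t * ((‖f t‖₊ : ℝ≥0∞)) ^ 2 ≤
      ENNReal.ofReal (w ^ 2) * ∫⁻ t in Ioo (L - w) L, ((‖f' t‖₊ : ℝ≥0∞)) ^ 2 := by
    calc ∫⁻ t, (Ici (L - w)).indicator (fun _ => (1 : ℝ≥0∞)) t * ((‖f t‖₊ : ℝ≥0∞)) ^ 2
        ≤ ∫⁻ t, (Ico (L - w) L).indicator (fun t => ((‖f t‖₊ : ℝ≥0∞)) ^ 2) t := by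
          refine lintegral_mono fun t => ?_
          by_cases ht : t ∈ Ico (L - w) L
          · simp only [indicator_of_mem ht, indicator_of_mem (show t ∈ Ici (L - w) from ht.1),
              one_mul, le_refl]
          · rcases lt_or_ge t L with htL | htL
            · simp only [indicator_of_notMem ht,
                indicator_of_notMem (show t ∉ Ici (L - w) from fun h => ht ⟨h, htL⟩), zero_mul,
                le_refl]
            · simp [hzero t fun h => (not_lt.2 htL) h.2]
      _ = ∫⁻ t in Ioo (L - w) L, ((‖f t‖₊ : ℝ≥0∞)) ^ 2 := by
          rw [lintegral_indicator measurableSet_Ico]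
          exact setLIntegral_congr Ioo_ae_eq_Ico.symm
      _ ≤ ENNReal.ofReal ((L - (L - w)) ^ 2) * ∫⁻ t in Ioo (L - w) L, ((‖f' t‖₊ : ℝ≥0∞)) ^ 2 :=
          poincare_Ioo_of_zero (tz := L) ⟨by linarith, le_rfl⟩ hL0 hderiv hcont'
      _ = ENNReal.ofReal (w ^ 2) * ∫⁻ t in Ioo (L - w) L, ((‖f' t‖₊ : ℝ≥0∞)) ^ 2 := by
          rw [sub_sub_cancel]
  -- the two slabs are disjoint (`2w ≤ L`), so the two derivative integrals add up below `∫ |f'|²`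
  have hdisj : Disjoint (Ioo 0 w) (Ioo (L - w) L) :=
    disjoint_left.2 fun t h1 h2 => by linarith [h1.2, h2.1]
  have hmI : Measurable fun t =>
      (Iic w).indicator (fun _ => (1 : ℝ≥0∞)) t * ((‖f t‖₊ : ℝ≥0∞)) ^ 2 :=
    (measurable_const.indicator measurableSet_Iic).mul hmf
  calc ∫⁻ t, ((Iic w).indicator (fun _ => (1 : ℝ≥0∞)) t +
          (Ici (L - w)).indicator (fun _ => (1 : ℝ≥0∞)) t) * ((‖f t‖₊ : ℝ≥0∞)) ^ 2
      = (∫⁻ t, (Iic w).indicator (fun _ => (1 : ℝ≥0∞)) t * ((‖f t‖₊ : ℝ≥0∞)) ^ 2) +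
          ∫⁻ t, (Ici (L - w)).indicator (fun _ => (1 : ℝ≥0∞)) t * ((‖f t‖₊ : ℝ≥0∞)) ^ 2 := by
        rw [← lintegral_add_left hmI]
        simp_rw [add_mul]
    _ ≤ ENNReal.ofReal (w ^ 2) * (∫⁻ t in Ioo 0 w, ((‖f' t‖₊ : ℝ≥0∞)) ^ 2) +
          ENNReal.ofReal (w ^ 2) * ∫⁻ t in Ioo (L - w) L, ((‖f' t‖₊ : ℝ≥0∞)) ^ 2 :=
        add_le_add hleft hright
    _ = ENNReal.ofReal (w ^ 2) * ∫⁻ t in Ioo 0 w ∪ Ioo (L - w) L, ((‖f' t‖₊ : ℝ≥0∞)) ^ 2 := by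
        rw [lintegral_union measurableSet_Ioo hdisj, mul_add]
    _ ≤ ENNReal.ofReal (w ^ 2) * ∫⁻ t, ((‖f' t‖₊ : ℝ≥0∞)) ^ 2 :=
        mul_le_mul_right (setLIntegral_le_lintegral _ _) _

/-! ### Configuration space: one particle, one axis -/

/-- The two-slab weight `X ↦ 1[x_{i,a} ≤ w] + 1[L - w ≤ x_{i,a}]` is measurable on configuration
space. [folklore] -/
theorem measurable_twoSlabWeight (i : Fin N) (a : Fin 3) :
    Measurable fun X : Config N => (Iic w).indicator (fun _ => (1 : ℝ≥0∞)) (X i a) +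
      (Ici (L - w)).indicator (fun _ => (1 : ℝ≥0∞)) (X i a) := by
  have hcoord : Measurable fun X : Config N => X i a := by fun_prop
  exact ((measurable_const.indicator measurableSet_Iic).comp hcoord).add
    ((measurable_const.indicator measurableSet_Ici).comp hcoord)

/-- **Two-slab Poincaré inequality for one particle and one axis.**  For a Dirichlet trial state
`Ψ` of `Λ_L`, `0 ≤ w`, `2w ≤ L`, a particle `i` and an axis `a`:
`∫ (1[x_{i,a} ≤ w] + 1[L - w ≤ x_{i,a}]) |Ψ|² ≤ w² ∫ |∂_{i,a}Ψ|²` (the line inequality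
`line_twoSlab_le` on every coordinate line parallel to `e_{i,a}`, then Fubini,
`lintegral_le_of_forall_line`). [folklore] -/
theorem config_twoSlab_le (hw : 0 ≤ w) (hwL : 2 * w ≤ L) (Ψ : TrialState N L) (i : Fin N)
    (a : Fin 3) :
    ∫⁻ X, ((Iic w).indicator (fun _ => (1 : ℝ≥0∞)) (X i a) +
          (Ici (L - w)).indicator (fun _ => (1 : ℝ≥0∞)) (X i a)) * ((‖Ψ.ψ X‖₊ : ℝ≥0∞)) ^ 2 ≤
      ENNReal.ofReal (w ^ 2) * ∫⁻ X, ((‖fderiv ℝ Ψ.ψ X (unitVec i a)‖₊ : ℝ≥0∞)) ^ 2 := by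
  have hmΨ : Measurable fun X : Config N => ((‖Ψ.ψ X‖₊ : ℝ≥0∞)) ^ 2 :=
    measurable_ennnormSq Ψ.contDiff.continuous
  have hmD : Measurable fun X : Config N => ((‖fderiv ℝ Ψ.ψ X (unitVec i a)‖₊ : ℝ≥0∞)) ^ 2 :=
    measurable_ennnormSq_fderiv_apply Ψ.contDiff _
  rw [← lintegral_const_mul _ hmD]
  refine lintegral_le_of_forall_line i a ((measurable_twoSlabWeight i a).mul hmΨ)
    (hmD.const_mul _) fun X y => ?_
  obtain ⟨hder, hcont, hcont', hzero⟩ := line_data Ψ i a X y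
  have hmDl : Measurable fun t =>
      ((‖fderiv ℝ Ψ.ψ (linePoint X i y a t) (unitVec i a)‖₊ : ℝ≥0∞)) ^ 2 :=
    hmD.comp (continuous_linePoint X i y a).measurable
  rw [lintegral_const_mul _ hmDl]
  simp only [linePoint_apply_self_self]
  exact line_twoSlab_le hw hwL hder hcont hcont' hzero

end BoundaryLayerPoincare

/-! ### The stub -/

open BoundaryLayerPoincare in
/-- **Stub `stub_boundaryLayerPoincare` — boundary-layer Poincaré inequality for Dirichlet trial
states.**  For `0 < w`, `2w ≤ L` and every Dirichlet trial state `Ψ` of `N` bosons in `Λ_L`, the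
expected number of particles within sup-distance `w` of the boundary of the box is at most `w²`
times the kinetic energy: `∑ᵢ ∫ 1[Xᵢ ∉ (w, L - w)³] |Ψ|² ≤ w² ∫ |∇Ψ|²`.  Cover the shell by the
six coordinate slabs (`shell_indicator_le`), apply the two-slab Poincaré inequality particle by
particle and axis by axis (`config_twoSlab_le`: `f(0) = f(L) = 0 ⇒ ∫₀ʷ|f|² ≤ w² ∫₀ʷ|f'|²`,
`∫_{L-w}^L |f|² ≤ w² ∫_{L-w}^L |f'|²` on every coordinate line), and add up the directional
energies (`sum_directionalEnergy_eq`). [cite: LSSY2005, Ch. 2 (2.3)] -/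
theorem stub_boundaryLayerPoincare : ∀ (N : ℕ) (L w : ℝ), 0 < w → 2 * w ≤ L → ∀ Ψ : Literature.MathematicalPhysics.QuantumManyBody.BoseGas.TrialState N L, (∑ i : Fin N, ∫⁻ X, {x : EuclideanSpace ℝ (Fin 3) | ∀ j, x j ∈ Set.Ioo w (L - w)}ᶜ.indicator (fun _ => (1 : ℝ≥0∞)) (X i) * (‖Ψ.ψ X‖₊ : ℝ≥0∞) ^ 2) ≤ ENNReal.ofReal (w ^ 2) * ∫⁻ X, Literature.MathematicalPhysics.QuantumManyBody.BoseGas.kineticDensity Ψ.ψ X := by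
  intro N L w hw hwL Ψ
  have hmΨ : Measurable fun X : Config N => ((‖Ψ.ψ X‖₊ : ℝ≥0∞)) ^ 2 :=
    measurable_ennnormSq Ψ.contDiff.continuous
  calc ∑ i : Fin N, ∫⁻ X, {x : EuclideanSpace ℝ (Fin 3) | ∀ j, x j ∈ Set.Ioo w (L - w)}ᶜ.indicator
          (fun _ => (1 : ℝ≥0∞)) (X i) * ((‖Ψ.ψ X‖₊ : ℝ≥0∞)) ^ 2
      ≤ ∑ i : Fin N, ∫⁻ X, (∑ a : Fin 3, ((Iic w).indicator (fun _ => (1 : ℝ≥0∞)) (X i a) +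
          (Ici (L - w)).indicator (fun _ => (1 : ℝ≥0∞)) (X i a))) * ((‖Ψ.ψ X‖₊ : ℝ≥0∞)) ^ 2 :=
        Finset.sum_le_sum fun i _ => lintegral_mono fun X =>
          mul_le_mul_left (shell_indicator_le w L (X i)) _
    _ = ∑ i : Fin N, ∑ a : Fin 3, ∫⁻ X, ((Iic w).indicator (fun _ => (1 : ℝ≥0∞)) (X i a) +
          (Ici (L - w)).indicator (fun _ => (1 : ℝ≥0∞)) (X i a)) * ((‖Ψ.ψ X‖₊ : ℝ≥0∞)) ^ 2 := by
        refine Finset.sum_congr rfl fun i _ => ?_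
        simp_rw [Finset.sum_mul]
        exact lintegral_finsetSum _ fun a _ => (measurable_twoSlabWeight i a).mul hmΨ
    _ ≤ ∑ i : Fin N, ∑ a : Fin 3, ENNReal.ofReal (w ^ 2) *
          ∫⁻ X, ((‖fderiv ℝ Ψ.ψ X (unitVec i a)‖₊ : ℝ≥0∞)) ^ 2 :=
        Finset.sum_le_sum fun i _ => Finset.sum_le_sum fun a _ => config_twoSlab_le hw.le hwL Ψ i a
    _ = ENNReal.ofReal (w ^ 2) * ∑ a : Fin 3, ∑ i : Fin N,
          ∫⁻ X, ((‖fderiv ℝ Ψ.ψ X (unitVec i a)‖₊ : ℝ≥0∞)) ^ 2 := by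
        rw [Finset.sum_comm, Finset.mul_sum]
        simp_rw [Finset.mul_sum]
    _ = ENNReal.ofReal (w ^ 2) *
          ∫⁻ X, Literature.MathematicalPhysics.QuantumManyBody.BoseGas.kineticDensity Ψ.ψ X := by
        rw [sum_directionalEnergy_eq Ψ.contDiff]

end Summit.AtomisticToContinuum.BoseEinsteinCondensation.Theorems.BecShellMass

end
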